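import Mathlib
import Summits.KontsevichZagierPeriods.KontsevichZagierPeriods.Theorems.SoloInformedShuffleChains
import Summits.KontsevichZagierPeriods.KontsevichZagierPeriods.Theorems.SoloInformedSumStar
import HarnessLib
import HarnessLib.Audit

/-!
# SoloInformed — the shuffle product `ζ(a)·ζ(b)` in the formal period ring (THEOREM XL)

Solo programme `solo-KontsevichZagierPeriods-informed`, session s46. Write `a = p + 2`,
`b = q + 2`, `n = a + b`. In `𝒫 = KZ.FormalPeriodRing` the product `mzvClass [a] * mzvClass [b]` is
the class of the PRODUCT REPRESENTATION `[Δ_a × Δ_b, ω_{0^{a-1}1} ⊗ ω_{0^{b-1}1}]` (Fubini is the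
ring structure of `𝒫`). Its domain is the open cube cut by the two chains
`t₀ > ⋯ > t_{a−1}`, `t_a > ⋯ > t_{n−1}` — an order polytope — and its integrand is the word-product
with the letter `1` exactly at the two chain bottoms `B₁ = a − 1`, `B₂ = n − 1`. The ORDER-CELL
ENGINE (THM XXXVIII) dissects it over the linear extensions `σ` of the two chains (the shuffles),
and each simplex piece is a double zeta value: if `M_σ` is the rank (from the bottom) of the
higher of the two chain minima, the piece of `σ` is `Z(n − M_σ, M_σ)`. Hence

  `mzvClass [a] * mzvClass [b] = ∑_{σ shuffle} mzvClass [n − M_σ, M_σ]`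

(`soloInformed_mzvClass_shuffle`), the shuffle product formula between ABSTRACT periods, for all
`a, b ≥ 2`; the fiberwise form `soloInformed_mzvClass_shuffle_count` exhibits the multiplicities as
cardinalities decided by `decide`, e.g. `ζ(2)ζ(3) = 6ζ(4,1) + 3ζ(3,2) + ζ(2,3)` in `𝒫`
(`soloInformed_mzvClass_shuffle_two_three`; `p = q = 0` is THM XXXII, `ζ(2)² = 4ζ(3,1) + 2ζ(2,2)`).

References: Kontsevich–Zagier 2001 §1.1–1.2 [KontsevichZagier2001]; Zagier 1994 §9; Hoffman 1992
(shuffle algebra); R. Stanley, Two poset polytopes (1986).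
-/

noncomputable section

open MeasureTheory Set
open Literature.ModelTheory.ExponentialFields Literature.NumberTheory.Transcendental
open Literature.NumberTheory.Transcendental.KZ

namespace Summit.KontsevichZagierPeriods.KontsevichZagierPeriods.Theorems

variable {p q : ℕ}

/-! ## 5. The pieces of a two-chain garland are double zeta values -/

section Pieces

variable (r : IntegralRep (p + 2 + (q + 2))) {σ : Equiv.Perm (Fin (p + 2 + (q + 2)))}

/-- **Dissection** of a representation on `(0,1)ⁿ ∩ P_E` over the shuffles (engine THM XXXVIII). -/
theorem soloInformed_sh_dissect
    (hd : r.domain = soloInformedOpenCube _ ∩ soloInformedOrderSet (soloInformedShPoset p q)) :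
    of r - ∑ σ ∈ Finset.univ.filter (soloInformedCompat (soloInformedShPoset p q)),
      of (soloInformedCellRep r σ) ∈ relations :=
  soloInformed_of_sub_sum_linext _ _ (by rw [hd]; exact inter_subset_right) _
    fun _ hσ => Finset.mem_filter.2 ⟨Finset.mem_univ _, hσ⟩

/-- The cell piece of a shuffle lives on the cube cell. -/
theorem soloInformed_shCellRep_domain
    (hd : r.domain = soloInformedOpenCube _ ∩ soloInformedOrderSet (soloInformedShPoset p q))
    (hσ : soloInformedCompat (soloInformedShPoset p q) σ) :
    (soloInformedCellRep r σ).domain = soloInformedOpenCube _ ∩ soloInformedCell σ := by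
  rw [soloInformedCellRep_domain, hd]
  exact soloInformed_inter_orderSet_inter_cell hσ _

/-- The simplex piece of a shuffle lives on Kontsevich's simplex. -/
theorem soloInformed_shPiece_domain
    (hd : r.domain = soloInformedOpenCube _ ∩ soloInformedOrderSet (soloInformedShPoset p q))
    (hσ : soloInformedCompat (soloInformedShPoset p q) σ) :
    ((soloInformedCellRep r σ).reindex (soloInformedCellPerm σ)).domain =
      openOrderedSimplex (p + 2 + (q + 2)) :=
  soloInformed_reindex_cubeCell_domain _ σ (soloInformed_shCellRep_domain r hd hσ)

/-- The double-zeta index `(a + b − M_σ, M_σ)` attached to a shuffle. -/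
def soloInformedShIdx (σ : Equiv.Perm (Fin (p + 2 + (q + 2)))) : List ℕ :=
  [p + q + 4 - soloInformedShM σ, soloInformedShM σ]

/-- The attached index is admissible. -/
theorem soloInformed_shIdx_admissible (hσ : soloInformedCompat (soloInformedShPoset p q) σ) :
    MZV.IsAdmissible (soloInformedShIdx σ) := by
  have h := soloInformed_shM_bounds hσ
  refine ⟨fun i hi => ?_, fun _ => ?_⟩
  · simp [soloInformedShIdx] at hi; omega
  · simp [soloInformedShIdx]; omega

/-- The attached index has weight `a + b`. -/
theorem soloInformed_shIdx_weight (hσ : soloInformedCompat (soloInformedShPoset p q) σ) :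
    MZV.weight (soloInformedShIdx σ) = p + 2 + (q + 2) := by
  have h := soloInformed_shM_bounds hσ
  simp [soloInformedShIdx, MZV.weight]; omega

/-- The word of the attached index. -/
theorem soloInformed_shIdx_getD (hσ : soloInformedCompat (soloInformedShPoset p q) σ)
    (k : Fin (p + 2 + (q + 2))) :
    (MZV.binaryWord (soloInformedShIdx σ)).getD k false =
      decide ((k : ℕ) = p + q + 3 - soloInformedShM σ ∨ (k : ℕ) = p + q + 3) := by
  have h := soloInformed_shM_bounds hσ
  unfold soloInformedShIdx
  rw [soloInformed_binaryWord_pair_getD _ _ _ (by omega) h.1]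
  exact decide_eq_decide.mpr (by omega)

/-- **The integrand of the simplex piece of a shuffle** is the word-product of its index. -/
theorem soloInformed_shPiece_integrand
    (hi : ∀ z, r.integrand z = ∏ k, mzvForm (soloInformedShEps p q k) (z k))
    (hσ : soloInformedCompat (soloInformedShPoset p q) σ) (w : Fin (p + 2 + (q + 2)) → ℝ) :
    ((soloInformedCellRep r σ).reindex (soloInformedCellPerm σ)).integrand w =
      ∏ k : Fin (p + 2 + (q + 2)),
        mzvForm ((MZV.binaryWord (soloInformedShIdx σ)).getD k false) (w k) := by
  show r.integrand (fun i => w (soloInformedCellPerm σ i)) = _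
  rw [hi, ← Equiv.prod_comp (soloInformedCellPerm σ) (fun k : Fin (p + 2 + (q + 2)) =>
    mzvForm ((MZV.binaryWord (soloInformedShIdx σ)).getD k false) (w k))]
  refine Finset.prod_congr rfl fun i _ => ?_
  congr 1
  rw [Bool.eq_iff_iff, soloInformed_shIdx_getD hσ, decide_eq_true_eq]
  exact soloInformed_shSlot_iff hσ i

/-- **Each simplex piece of a shuffle IS a double zeta class.** -/
theorem soloInformed_shPiece_class
    (hd : r.domain = soloInformedOpenCube _ ∩ soloInformedOrderSet (soloInformedShPoset p q))
    (hi : ∀ z, r.integrand z = ∏ k, mzvForm (soloInformedShEps p q k) (z k))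
    (hσ : soloInformedCompat (soloInformedShPoset p q) σ) :
    toFormalPeriod (of ((soloInformedCellRep r σ).reindex (soloInformedCellPerm σ))) =
      mzvClass (soloInformedShIdx σ) :=
  soloInformed_toFormalPeriod_eq_mzvClass (soloInformed_shIdx_admissible hσ)
    (soloInformed_shIdx_weight hσ) _ (soloInformed_shPiece_domain r hd hσ)
    (soloInformed_shPiece_integrand r hi hσ)

/-- The cell piece has the same class (rule (2) along the sorting permutation). -/
theorem soloInformed_shCellRep_class
    (hd : r.domain = soloInformedOpenCube _ ∩ soloInformedOrderSet (soloInformedShPoset p q))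
    (hi : ∀ z, r.integrand z = ∏ k, mzvForm (soloInformedShEps p q k) (z k))
    (hσ : soloInformedCompat (soloInformedShPoset p q) σ) :
    toFormalPeriod (of (soloInformedCellRep r σ)) = mzvClass (soloInformedShIdx σ) := by
  rw [← soloInformed_shPiece_class r hd hi hσ, toFormalPeriod_eq_iff]
  exact of_sub_of_reindex_mem_relations _ _

/-- **The class of a two-chain garland** is the sum of the double zetas of its shuffles. -/
theorem soloInformed_sh_class
    (hd : r.domain = soloInformedOpenCube _ ∩ soloInformedOrderSet (soloInformedShPoset p q))
    (hi : ∀ z, r.integrand z = ∏ k, mzvForm (soloInformedShEps p q k) (z k)) :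
    toFormalPeriod (of r) =
      ∑ σ ∈ Finset.univ.filter (soloInformedCompat (soloInformedShPoset p q)),
        mzvClass (soloInformedShIdx σ) := by
  rw [toFormalPeriod_eq_iff.2 (soloInformed_sh_dissect r hd), map_sum]
  exact Finset.sum_congr rfl fun σ hσ => soloInformed_shCellRep_class r hd hi (Finset.mem_filter.1 hσ).2

end Pieces

/-! ## 6. THEOREM XL — the shuffle product -/

/-- **THEOREM XL (the shuffle product `ζ(a)ζ(b)` in `𝒫`, all `a, b ≥ 2`).**
`mzvClass [a] * mzvClass [b] = ∑_{σ shuffle} mzvClass [a + b − M_σ, M_σ]`, the sum over the linear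
extensions of the two chains, `M_σ` the rank of the higher chain minimum. Every step is one of the
Kontsevich–Zagier rules: Fubini (the product of `𝒫`), (1a) (order cells), (2) (sorting
permutations); no analytic identity between real numbers is used. -/
theorem soloInformed_mzvClass_shuffle (p q : ℕ) :
    mzvClass [p + 2] * mzvClass [q + 2] =
      ∑ σ ∈ Finset.univ.filter (soloInformedCompat (soloInformedShPoset p q)),
        mzvClass [p + q + 4 - soloInformedShM σ, soloInformedShM σ] := by
  obtain ⟨ra, hda, hia, hca⟩ := soloInformed_exists_wordRep (u := [p + 2]) (N := p + 2)
    ⟨fun i hi => by simp at hi; omega, fun _ => by simp⟩ (by simp [MZV.weight])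
  obtain ⟨rb, hdb, hib, hcb⟩ := soloInformed_exists_wordRep (u := [q + 2]) (N := q + 2)
    ⟨fun i hi => by simp at hi; omega, fun _ => by simp⟩ (by simp [MZV.weight])
  rw [← hca, ← hcb, ← map_mul, of_mul_of]
  refine soloInformed_sh_class (ra.prod rb) ?_ fun z => ?_
  · rw [IntegralRep.prod_domain, ← soloInformed_prodSimplex_eq]
    ext z
    simp only [IntegralRep.mem_prodDomain, hda, hdb, mem_setOf_eq]
  · rw [IntegralRep.prod_integrand_eq, IntegralRep.prodFun_apply, hia, hib, soloInformed_shWordProd]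

/-- **THEOREM XL, fiberwise**: `ζ(a)ζ(b) = ∑_{M} #{σ shuffle : M_σ = M} · Z(a + b − M, M)` in `𝒫`,
the multiplicities being cardinalities of decidable finite sets (evaluated by `decide`). -/
theorem soloInformed_mzvClass_shuffle_count (p q : ℕ) :
    mzvClass [p + 2] * mzvClass [q + 2] = ∑ M ∈ Finset.range (p + q + 3),
      ((Finset.univ.filter (soloInformedCompat (soloInformedShPoset p q))).filter
        (fun σ => soloInformedShM σ = M)).card • mzvClass [p + q + 4 - M, M] := by
  rw [soloInformed_mzvClass_shuffle,
    ← Finset.sum_fiberwise_of_maps_to' (t := Finset.range (p + q + 3)) (g := fun σ => soloInformedShM σ)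
      (fun σ hσ => Finset.mem_range.2
        (Nat.lt_succ_of_le (soloInformed_shM_bounds (Finset.mem_filter.1 hσ).2).2))
      (fun M => mzvClass [p + q + 4 - M, M])]
  exact Finset.sum_congr rfl fun M _ => Finset.sum_const _

/-- **`ζ(2)·ζ(3) = 6ζ(4,1) + 3ζ(3,2) + ζ(2,3)` between abstract periods** (the `10 = 6 + 3 + 1`
shuffles of `01` and `001`, counted by the kernel). -/
theorem soloInformed_mzvClass_shuffle_two_three :
    mzvClass [2] * mzvClass [3] = 6 • mzvClass [4, 1] + 3 • mzvClass [3, 2] + mzvClass [2, 3] := by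
  have c0 : ((Finset.univ.filter (soloInformedCompat (soloInformedShPoset 0 1))).filter
      (fun σ => soloInformedShM σ = 0)).card = 0 := by decide
  have c1 : ((Finset.univ.filter (soloInformedCompat (soloInformedShPoset 0 1))).filter
      (fun σ => soloInformedShM σ = 1)).card = 6 := by decide
  have c2 : ((Finset.univ.filter (soloInformedCompat (soloInformedShPoset 0 1))).filter
      (fun σ => soloInformedShM σ = 2)).card = 3 := by decide
  have c3 : ((Finset.univ.filter (soloInformedCompat (soloInformedShPoset 0 1))).filter
      (fun σ => soloInformedShM σ = 3)).card = 1 := by decide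
  rw [show mzvClass [3] = mzvClass [1 + 2] from rfl, show mzvClass [2] = mzvClass [0 + 2] from rfl,
    soloInformed_mzvClass_shuffle_count 0 1]
  simp only [show 0 + 1 + 3 = 4 from rfl, show 0 + 1 + 4 = 5 from rfl, Finset.sum_range_succ,
    Finset.sum_range_zero, zero_add, c0, c1, c2, c3, zero_smul, one_smul, Nat.reduceSub]

/-- Numerical shadow under the period conjecture's evaluation map:
`ζ(2)ζ(3) = 6ζ(4,1) + 3ζ(3,2) + ζ(2,3)` in `ℝ`. -/
theorem soloInformed_multipleZeta_shuffle_two_three :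
    multipleZeta [2] * multipleZeta [3] =
      6 * multipleZeta [4, 1] + 3 * multipleZeta [3, 2] + multipleZeta [2, 3] := by
  have h := congrArg evalP soloInformed_mzvClass_shuffle_two_three
  simp only [map_mul, map_add, map_nsmul, evalP_mzvClass (by decide : MZV.IsAdmissible [2]),
    evalP_mzvClass (by decide : MZV.IsAdmissible [3]),
    evalP_mzvClass (by decide : MZV.IsAdmissible [4, 1]),
    evalP_mzvClass (by decide : MZV.IsAdmissible [3, 2]),
    evalP_mzvClass (by decide : MZV.IsAdmissible [2, 3])] at h
  simpa [nsmul_eq_mul] using h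

end Summit.KontsevichZagierPeriods.KontsevichZagierPeriods.Theorems
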